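import Mathlib
import Summits.Ventures.HodgeRepro2.T5CyclicSubquotient
import Summits.Ventures.HodgeRepro2.T5InertSphericalVector

/-!
# `π_{χ_λ}` IS THE SPHERICAL SUBQUOTIENT OF THE UNRAMIFIED PRINCIPAL SERIES `I(α q⁻²)`

Tier-5 support N3 / §G-N4.2 (seat p3, gen 85). Files 333–335 classified the irreducible `K`-spherical
representations of `U(J₃(u))` at an inert place by their `T₁`-eigenvalue `λ` (`π_{χ_λ}` = p8's `quotRep` of the
one-dimensional Hecke module `k_χ`, `χ(T₁) = λ`), and constructed the spherical vector `f₀ = sphericalVector c`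
of the unramified principal series `I(c)` with `T₁ f₀ = (q²(α + α⁻¹) + (q − 1)) f₀` at `c = α q⁻²`. What stayed
print was the PRINCIPAL-SERIES REALISATION of `π_{χ_λ}` itself. This file closes it in the form that is true for
EVERY parameter `α`: `π_{χ_λ}` is isomorphic to THE SPHERICAL SUBQUOTIENT OF `I(α q⁻²)` — the quotient of the
cyclic `G`-submodule `⟨G f₀⟩ ⊆ I(α q⁻²)` by a maximal proper `G`-stable subspace (file 336's `sphericalQuot`):

* **`inducedSubmodule`** — `I(c)` as a `G`-stable submodule of `G → k`; **`isInduced_of_mem_cyclicSpan`** —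
  `⟨G f₀⟩ ⊆ I(c)`; **`exists_eq_smul_sphericalVector`** — every right-`K`-invariant vector of `⟨G f₀⟩` is a
  multiple of `f₀` (`I(c)^K = k f₀` by the Iwasawa decomposition, file 216's `eq_smul_of_iwasawa`);
* **`inertSphericalQuot c`** — the spherical subquotient of `I(c)`; `isIrreducible_inertSphericalQuot`,
  `kFinite_inertSphericalQuot`, **`invariants_inertSphericalQuot_eq`** (its `K`-invariants are the line
  through `[f₀]`), `finiteDimensional_invariants_inertSphericalQuot`, `invariants_inertSphericalQuot_ne_bot`;
* **`heckeCharacter_inertSphericalQuot`** — its Hecke character at `T₁` is `q²(α + α⁻¹) + (q − 1)`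
  (the Macdonald–Satake identification of file 335 read on the subquotient);
* **`nonempty_equiv_inertSphericalQuot_quotRep`** — `π_{χ_λ} ≅ inertSphericalQuot (α q⁻²)` whenever
  `χ(T₁) = q²(α + α⁻¹) + (q − 1)` (file 334's uniqueness `nonempty_equiv_quotRep_char_iff`);
  **`exists_param_nonempty_equiv_inertSphericalQuot_quotRep`** — for every `λ` (`k` algebraically closed) some
  `α ≠ 0` realises `π_{χ_λ}` as the spherical subquotient of `I(α q⁻²)`.

What is NOT claimed: that `π_{χ_λ}` is a SUBrepresentation of `I(α q⁻²)` for the given `α` — at the reducible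
parameters the spherical constituent is a quotient of `I(α q⁻²)` and a subrepresentation only of `I(α⁻¹ q⁻²)`
(Casselman); the subquotient statement above is the one that holds for every `α`, and it is all the record's
rows 12–14 use (the eigenvalue and the uniqueness).

Nothing here is a statement about (P), theta lifts or L-values. §8(d): uses an L-value-free non-vanishing
device: NO.
-/

open Summit.Ventures.HodgeRepro2.T5HeckeBasisCells Summit.Ventures.HodgeRepro2.T5HeckePermutationModule
  Summit.Ventures.HodgeRepro2.LevelPositivity Summit.Ventures.HodgeRepro2.T5UnitaryGroupForm
  Summit.Ventures.HodgeRepro2.T5HermitianThreeElements Summit.Ventures.HodgeRepro2.T5UnitaryHeckeAdjoint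
  Summit.Ventures.HodgeRepro2.T5InertUnipotentResidue Summit.Ventures.HodgeRepro2.T5InertSatakeTransform
  Summit.Ventures.HodgeRepro2.T5InertPrincipalSeries Summit.Ventures.HodgeRepro2.T5InertIwasawa
  Summit.Ventures.HodgeRepro2.T5HeckeDoubleCoset Summit.Ventures.HodgeRepro2.T5InertUnipotentRadical
  Summit.Ventures.HodgeRepro2.T5InertIwasawaCosets Summit.Ventures.HodgeRepro2.T5InertSphericalClassification
  Summit.Ventures.HodgeRepro2.T5InertSphericalVector Summit.Ventures.HodgeRepro2.T5CyclicSubquotient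
  Summit.Ventures.HodgeRepro2.T5LevelIdempotent Summit.Ventures.HodgeRepro2.T5HeckeCommutativeMultiplicityOne
  Summit.Ventures.HodgeRepro2.T5HeckeInducedIrreducible Summit.Ventures.HodgeRepro2.T5HeckeCharacterRepresentation
  Summit.Ventures.HodgeRepro2.T5InertHeckeCharacter

namespace Summit.Ventures.HodgeRepro2.T5InertSphericalSubquotient

section Induced

variable {R E : Type*} [CommRing R] [Field E] [StarRing E] [Algebra R E] [IsFractionRing R E]
  (u : E) {ϖ : R} (hϖ : Irreducible ϖ) (hs : star (algebraMap R E ϖ) = algebraMap R E ϖ)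
  (k : Type*) [Field k]

/-- **`I(c)` as a submodule of `G → k`** (file 216's `isInduced_add` / `isInduced_zero` / `isInduced_smul`). -/
def inducedSubmodule (c : k) : Submodule k (formUnitaryGroup (J3 u) → k) where
  carrier := {f | IsInduced u hϖ hs k c f}
  add_mem' hf hf' := isInduced_add hf hf'
  zero_mem' := isInduced_zero c
  smul_mem' a _ hf := isInduced_smul hf a

/-- Membership in `I(c)`. -/
theorem mem_inducedSubmodule_iff {c : k} {f : formUnitaryGroup (J3 u) → k} :
    f ∈ inducedSubmodule u hϖ hs k c ↔ IsInduced u hϖ hs k c f := Iff.rfl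

/-- `I(c)` is stable under right translation (file 216's `isInduced_rightRegular`). -/
theorem inducedSubmodule_stable (c : k) :
    ∀ (g : formUnitaryGroup (J3 u)) ⦃f : formUnitaryGroup (J3 u) → k⦄,
      f ∈ inducedSubmodule u hϖ hs k c → rightRegular k g f ∈ inducedSubmodule u hϖ hs k c :=
  fun g _ hf => isInduced_rightRegular hf g

end Induced

section Inert

variable {R E : Type*} [CommRing R] [Field E] [StarRing E] [Algebra R E] [IsFractionRing R E] [IsDomain R]
  [IsDiscreteValuationRing R] [Finite (IsLocalRing.ResidueField R)]
  (hstar : ∀ x : E, IsLocalization.IsInteger R x → IsLocalization.IsInteger R (star x))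
  (u : E) (hsu : star u = u) (hu0 : u ≠ 0) (hu : IsLocalization.IsInteger R u)
  (hu' : IsLocalization.IsInteger R u⁻¹) {ϖ : R} (hϖ : Irreducible ϖ)
  (hs : star (algebraMap R E ϖ) = algebraMap R E ϖ) (k : Type*) [Field k]

/-- The spherical vector is non-zero (`f₀(1) = 1`). -/
theorem sphericalVector_ne_zero (c : k) : sphericalVector hstar u hsu hu0 hu hu' hϖ hs k c ≠ 0 := by
  intro h
  have h1 := sphericalVector_one hstar u hsu hu0 hu hu' hϖ hs k c
  rw [h, Pi.zero_apply] at h1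
  exact zero_ne_one h1

/-- **`⟨G f₀⟩ ⊆ I(c)`**: the cyclic submodule generated by the spherical vector lies in the principal series
(`I(c)` is `G`-stable and contains `f₀`; file 336's `cyclicSpan_le`). -/
theorem isInduced_of_mem_cyclicSpan {c : k} (hc : c ≠ 0) {w : formUnitaryGroup (J3 u) → k}
    (hw : w ∈ cyclicSpan (rightRegular k) (sphericalVector hstar u hsu hu0 hu hu' hϖ hs k c)
      (sphericalVector_mem_invariants hstar u hsu hu0 hu hu' hϖ hs k c)) :
    IsInduced u hϖ hs k c w :=
  cyclicSpan_le (rightRegular k) (sphericalVector hstar u hsu hu0 hu hu' hϖ hs k c)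
    (sphericalVector_mem_invariants hstar u hsu hu0 hu hu' hϖ hs k c) (N := inducedSubmodule u hϖ hs k c)
    (inducedSubmodule_stable u hϖ hs k c) (isInduced_sphericalVector hstar u hsu hu0 hu hu' hϖ hs k hc) hw

/-- **Every right-`K`-invariant vector of `⟨G f₀⟩` is a multiple of `f₀`**: it lies in `I(c)`, and
`I(c)^K = k f₀` by the Iwasawa decomposition `G = N {a_m} K` (file 216's `eq_smul_of_iwasawa`). -/
theorem exists_eq_smul_sphericalVector {c : k} (hc : c ≠ 0) :
    ∀ w ∈ cyclicSpan (rightRegular k) (sphericalVector hstar u hsu hu0 hu hu' hϖ hs k c)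
        (sphericalVector_mem_invariants hstar u hsu hu0 hu hu' hϖ hs k c),
      w ∈ invariants (rightRegular k) (hyperspecialSubgroup R (J3 u)) →
        ∃ a : k, w = a • sphericalVector hstar u hsu hu0 hu hu' hϖ hs k c := by
  intro w hw hwK
  exact ⟨w 1, eq_smul_of_iwasawa (fun g => exists_mem_mul_cellZ_mul hstar u hsu hu0 hu hu' hϖ hs g)
    (isInduced_of_mem_cyclicSpan hstar u hsu hu0 hu hu' hϖ hs k hc hw)
    ((mem_invariants_rightRegular_iff k _ w).1 hwK)
    (isInduced_sphericalVector hstar u hsu hu0 hu hu' hϖ hs k hc)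
    ((mem_invariants_rightRegular_iff k _ _).1 (sphericalVector_mem_invariants hstar u hsu hu0 hu hu' hϖ hs k c))
    (sphericalVector_one hstar u hsu hu0 hu hu' hϖ hs k c)⟩

/-- **THE SPHERICAL SUBQUOTIENT OF `I(c)`**: the quotient of `⟨G f₀⟩ ⊆ I(c)` by a maximal proper `G`-stable
subspace (file 336's `sphericalQuot` on the right regular representation and the spherical vector). -/
noncomputable abbrev inertSphericalQuot (c : k) :=
  sphericalQuot (rightRegular k) (sphericalVector hstar u hsu hu0 hu hu' hϖ hs k c)
    (sphericalVector_mem_invariants hstar u hsu hu0 hu hu' hϖ hs k c)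
    (sphericalVector_ne_zero hstar u hsu hu0 hu hu' hϖ hs k c)

/-- The spherical subquotient of `I(c)` is irreducible. -/
theorem isIrreducible_inertSphericalQuot (c : k) : (inertSphericalQuot hstar u hsu hu0 hu hu' hϖ hs k c).IsIrreducible :=
  isIrreducible_sphericalQuot _ _ _ _

/-- The spherical subquotient of `I(c)` is `K`-finite. -/
theorem kFinite_inertSphericalQuot (c : k) :
    KFinite (inertSphericalQuot hstar u hsu hu0 hu hu' hϖ hs k c) (hyperspecialSubgroup R (J3 u)) :=
  kFinite_sphericalQuot _ _ _ (fun _ => inferInstance) _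

/-- The `K`-invariants of the spherical subquotient are non-zero. -/
theorem invariants_inertSphericalQuot_ne_bot (c : k) :
    invariants (inertSphericalQuot hstar u hsu hu0 hu hu' hϖ hs k c) (hyperspecialSubgroup R (J3 u)) ≠ ⊥ :=
  invariants_sphericalQuot_ne_bot _ _ _ _

variable [CharZero k]

/-- **The `K`-invariants of the spherical subquotient of `I(c)` are the line through `[f₀]`** (`c ≠ 0`). -/
theorem invariants_inertSphericalQuot_eq {c : k} (hc : c ≠ 0) :
    invariants (inertSphericalQuot hstar u hsu hu0 hu hu' hϖ hs k c) (hyperspecialSubgroup R (J3 u)) =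
      k ∙ (Submodule.Quotient.mk (gen (rightRegular k) (sphericalVector hstar u hsu hu0 hu hu' hϖ hs k c)
        (sphericalVector_mem_invariants hstar u hsu hu0 hu hu' hϖ hs k c))) :=
  invariants_sphericalQuot_eq _ _ _ (fun _ => inferInstance) _
    (exists_eq_smul_sphericalVector hstar u hsu hu0 hu hu' hϖ hs k hc)

/-- The `K`-invariants of the spherical subquotient are finite-dimensional (`c ≠ 0`). -/
theorem finiteDimensional_invariants_inertSphericalQuot {c : k} (hc : c ≠ 0) :
    FiniteDimensional k
      (invariants (inertSphericalQuot hstar u hsu hu0 hu hu' hϖ hs k c) (hyperspecialSubgroup R (J3 u))) :=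
  finiteDimensional_invariants_sphericalQuot _ _ _ (fun _ => inferInstance) _
    (exists_eq_smul_sphericalVector hstar u hsu hu0 hu hu' hϖ hs k hc)

variable (he : ∃ e : R, algebraMap R E e + star (algebraMap R E e) = 1)
  (hnt : ∃ t, T5InertResidueInvolution.residueStar hstar hϖ hs t ≠ t)

include he hnt in
/-- **`T₁ · f₀ = (q²(α + α⁻¹) + (q − 1)) • f₀`** with `T₁ = heckeBasisCells … 1` (file 335's Macdonald–Satake
identification, `heckeBasisCells_apply`). -/
theorem heckeSMul_heckeBasisCells_one_sphericalVector {α : k} (hα : α ≠ 0) :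
    heckeSMul (rightRegular k) (heckeBasisCells hstar u hsu hu0 hu hu' hϖ hs k 1)
        ⟨sphericalVector hstar u hsu hu0 hu hu' hϖ hs k (α * ((Nat.card (traceZero R E) : k) ^ 2)⁻¹),
          sphericalVector_mem_invariants hstar u hsu hu0 hu hu' hϖ hs k _⟩ =
      ((Nat.card (traceZero R E) : k) ^ 2 * (α + α⁻¹) + ((Nat.card (traceZero R E) : k) - 1)) •
        ⟨sphericalVector hstar u hsu hu0 hu hu' hϖ hs k (α * ((Nat.card (traceZero R E) : k) ^ 2)⁻¹),
          sphericalVector_mem_invariants hstar u hsu hu0 hu hu' hϖ hs k _⟩ := by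
  rw [heckeBasisCells_apply]
  exact heckeSMul_cellU_one_sphericalVector hstar u hsu hu0 hu hu' hϖ hs k he hnt hα

omit [IsFractionRing R E] in
/-- `α q⁻² ≠ 0` for `α ≠ 0`. -/
theorem param_mul_inv_ne_zero {α : k} (hα : α ≠ 0) : α * ((Nat.card (traceZero R E) : k) ^ 2)⁻¹ ≠ 0 :=
  mul_ne_zero hα (inv_ne_zero (pow_ne_zero 2 (natCast_card_traceZero_ne_zero (R := R) (E := E) k)))

variable [IsAlgClosed k]

include he hnt in
/-- **THE HECKE CHARACTER OF THE SPHERICAL SUBQUOTIENT OF `I(α q⁻²)` AT `T₁` IS `q²(α + α⁻¹) + (q − 1)`.** -/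
theorem heckeCharacter_inertSphericalQuot {α : k} (hα : α ≠ 0) :
    haveI := isIrreducible_inertSphericalQuot hstar u hsu hu0 hu hu' hϖ hs k
      (α * ((Nat.card (traceZero R E) : k) ^ 2)⁻¹)
    haveI := finiteDimensional_invariants_inertSphericalQuot hstar u hsu hu0 hu hu' hϖ hs k
      (param_mul_inv_ne_zero (R := R) (E := E) k hα)
    heckeCharacter (inertSphericalQuot hstar u hsu hu0 hu hu' hϖ hs k (α * ((Nat.card (traceZero R E) : k) ^ 2)⁻¹))
        (kFinite_inertSphericalQuot hstar u hsu hu0 hu hu' hϖ hs k _) (fun _ => inferInstance)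
        (invariants_inertSphericalQuot_ne_bot hstar u hsu hu0 hu hu' hϖ hs k _)
        (mul_comm' hstar u hsu hu0 hu hu' hϖ hs k) (heckeBasisCells hstar u hsu hu0 hu hu' hϖ hs k 1) =
      (Nat.card (traceZero R E) : k) ^ 2 * (α + α⁻¹) + ((Nat.card (traceZero R E) : k) - 1) :=
  heckeCharacter_sphericalQuot (rightRegular k) _ _ (fun _ => inferInstance) _
    (exists_eq_smul_sphericalVector hstar u hsu hu0 hu hu' hϖ hs k (param_mul_inv_ne_zero (R := R) (E := E) k hα))
    (mul_comm' hstar u hsu hu0 hu hu' hϖ hs k) _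
    (heckeSMul_heckeBasisCells_one_sphericalVector hstar u hsu hu0 hu hu' hϖ hs k he hnt hα)

include he hnt in
/-- **`π_{χ_λ}` IS THE SPHERICAL SUBQUOTIENT OF `I(α q⁻²)`**: for `χ(T₁) = q²(α + α⁻¹) + (q − 1)`, the irreducible
`K`-spherical representation `π_χ` of files 333–334 is isomorphic to the spherical subquotient of the unramified
principal series `I(α q⁻²)` (file 334's uniqueness `nonempty_equiv_quotRep_char_iff`). -/
theorem nonempty_equiv_inertSphericalQuot_quotRep {α : k} (hα : α ≠ 0)
    (χ : heckeAlgebra k (hyperspecialSubgroup R (J3 u)) →ₐ[k] k)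
    (hχ : χ (heckeBasisCells hstar u hsu hu0 hu hu' hϖ hs k 1) =
      (Nat.card (traceZero R E) : k) ^ 2 * (α + α⁻¹) + ((Nat.card (traceZero R E) : k) - 1)) :
    letI := charModule k (hyperspecialSubgroup R (J3 u)) χ
    letI := charScalarTower k (hyperspecialSubgroup R (J3 u)) χ
    haveI := isIrreducible_quotRep_char k (hyperspecialSubgroup R (J3 u)) (fun _ => inferInstance) χ
    haveI := finiteDimensional_invariants_quotRep_char k (hyperspecialSubgroup R (J3 u))
      (fun _ => inferInstance) χ
    haveI := isIrreducible_inertSphericalQuot hstar u hsu hu0 hu hu' hϖ hs k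
      (α * ((Nat.card (traceZero R E) : k) ^ 2)⁻¹)
    haveI := finiteDimensional_invariants_inertSphericalQuot hstar u hsu hu0 hu hu' hϖ hs k
      (param_mul_inv_ne_zero (R := R) (E := E) k hα)
    Nonempty ((inertSphericalQuot hstar u hsu hu0 hu hu' hϖ hs k
      (α * ((Nat.card (traceZero R E) : k) ^ 2)⁻¹)).Equiv
        (quotRep k (hyperspecialSubgroup R (J3 u)) k (fun _ => inferInstance))) := by
  letI := charModule k (hyperspecialSubgroup R (J3 u)) χ
  letI := charScalarTower k (hyperspecialSubgroup R (J3 u)) χ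
  haveI := isIrreducible_quotRep_char k (hyperspecialSubgroup R (J3 u)) (fun _ => inferInstance) χ
  haveI := finiteDimensional_invariants_quotRep_char k (hyperspecialSubgroup R (J3 u))
    (fun _ => inferInstance) χ
  haveI := isIrreducible_inertSphericalQuot hstar u hsu hu0 hu hu' hϖ hs k
    (α * ((Nat.card (traceZero R E) : k) ^ 2)⁻¹)
  haveI := finiteDimensional_invariants_inertSphericalQuot hstar u hsu hu0 hu hu' hϖ hs k
    (param_mul_inv_ne_zero (R := R) (E := E) k hα)
  exact (nonempty_equiv_quotRep_char_iff hstar u hsu hu0 hu hu' hϖ hs k _ χ hχ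
    (inertSphericalQuot hstar u hsu hu0 hu hu' hϖ hs k (α * ((Nat.card (traceZero R E) : k) ^ 2)⁻¹))
    (kFinite_inertSphericalQuot hstar u hsu hu0 hu hu' hϖ hs k _)
    (invariants_inertSphericalQuot_ne_bot hstar u hsu hu0 hu hu' hϖ hs k _)).2
    (heckeCharacter_inertSphericalQuot hstar u hsu hu0 hu hu' hϖ hs k he hnt hα)

include he hnt in
/-- **EVERY `K`-SPHERICAL IRREDUCIBLE REPRESENTATION IS A SPHERICAL SUBQUOTIENT OF AN UNRAMIFIED PRINCIPAL
SERIES**: for every `λ : k` and every character `χ` with `χ(T₁) = λ` there is `α ≠ 0` with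
`λ = q²(α + α⁻¹) + (q − 1)` and `π_χ ≅ inertSphericalQuot (α q⁻²)`. -/
theorem exists_param_nonempty_equiv_inertSphericalQuot_quotRep (lam : k)
    (χ : heckeAlgebra k (hyperspecialSubgroup R (J3 u)) →ₐ[k] k)
    (hχ : χ (heckeBasisCells hstar u hsu hu0 hu hu' hϖ hs k 1) = lam) :
    ∃ α : k, α ≠ 0 ∧
      lam = (Nat.card (traceZero R E) : k) ^ 2 * (α + α⁻¹) + ((Nat.card (traceZero R E) : k) - 1) ∧
      letI := charModule k (hyperspecialSubgroup R (J3 u)) χ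
      letI := charScalarTower k (hyperspecialSubgroup R (J3 u)) χ
      haveI := isIrreducible_quotRep_char k (hyperspecialSubgroup R (J3 u)) (fun _ => inferInstance) χ
      haveI := finiteDimensional_invariants_quotRep_char k (hyperspecialSubgroup R (J3 u))
        (fun _ => inferInstance) χ
      haveI := isIrreducible_inertSphericalQuot hstar u hsu hu0 hu hu' hϖ hs k
        (α * ((Nat.card (traceZero R E) : k) ^ 2)⁻¹)
      Nonempty ((inertSphericalQuot hstar u hsu hu0 hu hu' hϖ hs k
        (α * ((Nat.card (traceZero R E) : k) ^ 2)⁻¹)).Equiv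
          (quotRep k (hyperspecialSubgroup R (J3 u)) k (fun _ => inferInstance))) := by
  obtain ⟨α, hα, hlam⟩ := exists_param_eq ((Nat.card (traceZero R E) : ℕ) : k)
    (natCast_card_traceZero_ne_zero (R := R) (E := E) k) lam
  exact ⟨α, hα, hlam,
    nonempty_equiv_inertSphericalQuot_quotRep hstar u hsu hu0 hu hu' hϖ hs k he hnt hα χ (hχ.trans hlam)⟩

end Inert

end Summit.Ventures.HodgeRepro2.T5InertSphericalSubquotient
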